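import Literature.NumberTheory.LFunctions.BondarenkoHeap2026Sections3to5
import Literature.NumberTheory.LFunctions.BondarenkoHeap2026Sections3to5Proofs
import Literature.NumberTheory.LFunctions.BondarenkoHeap2026Eq14Local
import Literature.NumberTheory.LFunctions.BondarenkoHeap2026Section6Proofs
import Literature.NumberTheory.LFunctions.KloostermanQuadraticTwist
import Literature.NumberTheory.LFunctions.PrimitiveQuadraticCharacter
import HarnessLib

/-!
# Bondarenko–Heap 2026, §4 — proof of (14): the complete sums `S_q(k, r; b)`

LABEL (cell `rh-crit`, corpus C5 `ah`): **NOT RH-BEARING.** This file PROVES the named fact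
`BondarenkoHeap2026.eq14` of `Literature/NumberTheory/LFunctions/BondarenkoHeap2026Sections3to5.lean`
(display (14) of [BondarenkoHeap2026], arXiv:2608.07399v1, §4 p. 11, TeX l.546–550, internal to the
proof of Lemma 4): for the primitive quadratic character `χ` modulo `q = 2^ν Q` (`Q` odd) and
nonzero integers `k, r`,
`|S_q(k, r; 0)| ≪_ε q^ε (r, Q)` and `|S_q(k, r; b)| ≪_ε q^{1/2+ε} (r, b, Q)^{1/2}` (`b ≠ 0`), where
`S_q(k, r; b) = ∑_{a mod q} χ(a) χ(ak + r) e(−ab/q)` (`twistedShiftSum`).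

* `BondarenkoHeap2026.eq14_holds : eq14`;
* `BondarenkoHeap2026.lemma4_holds : lemma4` — Lemma 4 itself, by the sibling file's
  `lemma4_of_eq14` ([BondarenkoHeap2026Sections3to5Proofs]: (13) + (14) + partial summation);
* `BondarenkoHeap2026.rangeI_bound_holds : rangeI_bound` — the Range I bound (23) of §6.3 outright, by
  the sibling file's `rangeI_bound_of_lemma4` ([BondarenkoHeap2026Section6Proofs]).

Proof (the printed one, TeX l.530–545: "by the Chinese remainder theorem `S_q = S_{2^ν} ∏ S_{p_i}`
… `∑_{a mod p} χ_p(a)χ_p(ak+1) = −χ_p(k)` … a Gauss sum or the Weil bound for a quadratic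
polynomial"), with every input a tree theorem:
1. twisted CRT multiplicativity of `S_q` — the sibling file's
   `BondarenkoHeap2026.twistedShiftSum_eq_mul_of_coprime` ([BondarenkoHeap2026Eq14Local], which also
   holds per-case local evaluations; here the local bound is restated in the single unified shape
   `β_p` that the induction below consumes);
2. the local factor at an odd prime `p`, where the `p`-component is the Legendre symbol
   (`PrimitiveQuadratic.eq_quadraticChar_of_isQuadratic`): `p ∣ k` gives `χ_p(r)` times a Gauss
   sum (Mathlib `gaussSum_sq`), `p ∤ k` gives after `a ↦ a/k` the sum `∑_y χ_p(y(y − t)) e(sy/p)`, which is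
   `e(st/2p) S(1, (st/4)²; p)` (`sum_quadraticChar_mul_sub_mul_stdAddChar`, Kunisky–Yu Prop. 4.11)
   with Weil's bound `|S| ≤ 2√p` (`norm_kloostermanSum_one_prime_le`, PROVED in the tree), `−1` at
   `s = 0` (Jacobsthal), and a Ramanujan sum `p − 1` or `−1` when `p ∣ r`; in all cases
   `|S_p| ≤ β_p := [p ∣ b]([p ∣ r](p − 1) + [p ∤ r]) + [p ∤ b] 2√p` (`norm_twistedShiftSum_prime_le`);
3. `|S_q| ≤ 2^ν ∏_{p ∣ Q} β_p` by induction on the odd square-free part `Q` (square-free by the tree's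
   `PrimitiveQuadratic.squarefree_of_isPrimitive_of_isQuadratic`; `ν ≤ 3` by
   `eq_two_or_three_of_isPrimitive_two_pow`), the `2`-part bounded trivially;
4. `∏ β_p ≤ (r, Q)` at `b = 0` and `∏ β_p ≤ 2^{ω(Q)} √Q (r, b, Q)^{1/2}` for `b ≠ 0`, with
   `2^{ω(Q)} ≤ d(Q) ≤ C_ε Q^ε` (`Nat.card_divisors`, `Sieve.exists_card_divisors_le_mul_rpow`).
All constants are effective (`C = 8 C_ε`). Nothing here bears on the truth of RH. No definitions,
no new named facts.

## References

* [BondarenkoHeap2026] A. Bondarenko, W. Heap, *Siegel zeros and small gaps between zeros of the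
  Riemann zeta function*, arXiv:2608.07399v1, §4, (13)–(14) and Lemma 4 (pp. 10–11; TeX l.495–552).
* [KuniskyYu2022] D. Kunisky, X. Yu, arXiv:2211.02713, Proposition 4.11 (the Salié evaluation).
* [MontgomeryVaughan2007] H. L. Montgomery, R. C. Vaughan, *Multiplicative Number Theory I*, §9.3
  (real primitive characters), Lemma 9.3 (CRT components).
-/

noncomputable section

open Finset Complex

namespace Literature.NumberTheory.LFunctions

namespace BondarenkoHeap2026

namespace CompleteSums

open DirichletCharacter

/-! ### 1. Twisted CRT multiplicativity of `S_q(k, r; b)`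

This is `BondarenkoHeap2026.twistedShiftSum_eq_mul_of_coprime` of the sibling file
`BondarenkoHeap2026Eq14Local` (landed first; not restated here):
`S_{ab}(k, r; c) = S_a(k, r; (c mod a)·b̄) · S_b(k, r; (c mod b)·ā)` for `(a, b) = 1`. -/

/-! ### 2. The local factor at an odd prime -/

/-- **The local bound at an odd prime `p`** for a non-principal quadratic character `ψ` of `ℤ/p`
(the Legendre symbol): `|S_p(k, r; b)| ≤ β_p`, where `β_p = p − 1` if `p ∣ b`, `p ∣ r`; `β_p = 1`
if `p ∣ b`, `p ∤ r`; `β_p = 2√p` if `p ∤ b` ("`∑_{a mod p} χ_p(a)χ_p(ak+1) = −χ_p(k)` … a Gauss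
sum or the Weil bound for a quadratic polynomial", TeX l.535–545; the `p ∤ k`, `p ∤ b` case is the
Salié sum `e(st/2p) S(1,(st/4)²;p)` of Kunisky–Yu Prop. 4.11 with Weil's `|S| ≤ 2√p`).
[cite: BondarenkoHeap2026, §4 proof of Lemma 4 (TeX l.535–545)] -/
theorem norm_twistedShiftSum_prime_le {p : ℕ} [Fact p.Prime] [NeZero p] (hp2 : p ≠ 2)
    (ψ : DirichletCharacter ℂ p) (hψ1 : ψ ≠ 1) (hψq : ψ.IsQuadratic) (k r : ℤ) (b : ZMod p) :
    ‖twistedShiftSum ψ k r b‖ ≤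
      if b = 0 then (if (r : ZMod p) = 0 then (p : ℝ) - 1 else 1) else 2 * Real.sqrt p := by
  have hp : p.Prime := Fact.out
  have hp1 : (1 : ℝ) ≤ Real.sqrt p := by
    rw [show (1 : ℝ) = Real.sqrt 1 by simp]
    exact Real.sqrt_le_sqrt (by exact_mod_cast hp.one_lt.le)
  have hpR : (1 : ℝ) ≤ (p : ℝ) - 1 := by
    have : (2 : ℝ) ≤ p := by exact_mod_cast hp.two_le
    linarith
  -- nonnegativity of the right-hand side (all three branches are `≥ 1`)
  have hRHS1 : (1 : ℝ) ≤
      (if b = 0 then (if (r : ZMod p) = 0 then (p : ℝ) - 1 else 1) else 2 * Real.sqrt p) := by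
    split_ifs <;> linarith
  -- `ψ` is the Legendre symbol
  have hL := PrimitiveQuadratic.eq_quadraticChar_of_isQuadratic hp2 hψq hψ1
  have hLap : ∀ x : ZMod p, ψ x = ((quadraticChar (ZMod p) x : ℤ) : ℂ) := fun x => by
    rw [hL, MulChar.ringHomComp_apply]; rfl
  by_cases hk : (k : ZMod p) = 0
  · -- `p ∣ k`: `S = ψ(r) ∑_a ψ(a) e(−ab/p)`
    have hS : twistedShiftSum ψ k r b =
        ψ r * ∑ a : ZMod p, ψ a * (ZMod.stdAddChar (-(a * b)) : ℂ) := by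
      simp only [twistedShiftSum, hk, mul_zero, zero_add, Finset.mul_sum]
      refine Finset.sum_congr rfl fun a _ => ?_
      ring
    by_cases hb : b = 0
    · subst hb
      have h0 : ∑ a : ZMod p, ψ a * (ZMod.stdAddChar (-(a * (0 : ZMod p))) : ℂ) = 0 := by
        simp only [mul_zero, neg_zero, AddChar.map_zero_eq_one, mul_one]
        exact MulChar.sum_eq_zero_of_ne_one hψ1
      rw [hS, h0, mul_zero, norm_zero]
      exact le_trans zero_le_one hRHS1
    · -- a twisted Gauss sum
      rw [if_neg hb]
      set u : (ZMod p)ˣ := Units.mk0 (-b) (neg_ne_zero.mpr hb) with hu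
      have hG : ∑ a : ZMod p, ψ a * (ZMod.stdAddChar (-(a * b)) : ℂ) =
          gaussSum ψ ((ZMod.stdAddChar (N := p)).mulShift u) := by
        simp only [gaussSum, AddChar.mulShift_apply, hu, Units.val_mk0]
        refine Finset.sum_congr rfl fun a _ => ?_
        congr 2
        ring
      -- `‖τ(ψ)‖ = √p` for the quadratic `ψ ≠ 1` (Mathlib `gaussSum_sq`: `τ(ψ)² = ψ(−1) p`)
      have hτ : ‖gaussSum ψ (ZMod.stdAddChar (N := p))‖ = Real.sqrt p := by
        have hsq := gaussSum_sq hψ1 hψq (ZMod.isPrimitive_stdAddChar p)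
        rw [ZMod.card p] at hsq
        have hm1 : ‖ψ (-1)‖ = 1 := by
          rcases hψq (-1) with h0 | h1 | h2
          · exact absurd h0 (IsUnit.ne_zero ((isUnit_one.neg).map ψ))
          · rw [h1, norm_one]
          · rw [h2, norm_neg, norm_one]
        have hnorm : ‖gaussSum ψ (ZMod.stdAddChar (N := p))‖ ^ 2 = p := by
          rw [← norm_pow, hsq, norm_mul, hm1, one_mul, Complex.norm_natCast]
        rw [← Real.sqrt_sq (norm_nonneg _), hnorm]
      rw [hS, hG, gaussSum_mulShift_eq, norm_mul, norm_mul, hτ]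
      have h1 : ‖ψ r‖ ≤ 1 := DirichletCharacter.norm_le_one ψ _
      have h2 : ‖ψ⁻¹ (u : ZMod p)‖ ≤ 1 := DirichletCharacter.norm_le_one ψ⁻¹ _
      have h3 : 0 ≤ Real.sqrt p := Real.sqrt_nonneg _
      calc ‖ψ ↑r‖ * (‖ψ⁻¹ ↑u‖ * Real.sqrt p) ≤ 1 * (1 * Real.sqrt p) := by gcongr
        _ ≤ 2 * Real.sqrt p := by linarith
  · -- `p ∤ k`: substitute `a = y/k`
    set κ : ZMod p := (k : ZMod p) with hκ
    set t : ZMod p := -(r : ZMod p) with ht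
    set s : ZMod p := -(κ⁻¹ * b) with hs
    have hS : twistedShiftSum ψ k r b = ψ κ⁻¹ *
        ∑ y : ZMod p, ((quadraticChar (ZMod p) (y * (y - t)) : ℤ) : ℂ) *
          (ZMod.stdAddChar (s * y) : ℂ) := by
      simp only [twistedShiftSum]
      rw [← Fintype.sum_bijective (· * κ⁻¹) (mulRight_bijective₀ κ⁻¹ (inv_ne_zero hk)) _ _
        (fun _ => rfl)]
      rw [Finset.mul_sum]
      refine Finset.sum_congr rfl fun y _ => ?_
      have e1 : y * κ⁻¹ * κ + (r : ZMod p) = y - t := by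
        rw [ht, inv_mul_cancel_right₀ hk]; ring
      have e2 : -(y * κ⁻¹ * b) = s * y := by rw [hs]; ring
      have e3 : ((quadraticChar (ZMod p) (y * (y - t)) : ℤ) : ℂ) =
          ((quadraticChar (ZMod p) y : ℤ) : ℂ) * ((quadraticChar (ZMod p) (y - t) : ℤ) : ℂ) := by
        rw [map_mul, Int.cast_mul]
      rw [← hκ, e1, e2, map_mul, hLap y, hLap (y - t), e3]
      ring
    have hκ1 : ‖ψ κ⁻¹‖ ≤ 1 := DirichletCharacter.norm_le_one ψ _
    rw [hS, norm_mul]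
    -- it suffices to bound the inner sum by the right-hand side (which is `≥ 0`)
    suffices hin : ‖∑ y : ZMod p, ((quadraticChar (ZMod p) (y * (y - t)) : ℤ) : ℂ) *
        (ZMod.stdAddChar (s * y) : ℂ)‖ ≤
        (if b = 0 then (if (r : ZMod p) = 0 then (p : ℝ) - 1 else 1) else 2 * Real.sqrt p) by
      calc ‖ψ κ⁻¹‖ * _ ≤ 1 * _ := by gcongr
        _ = _ := one_mul _
    by_cases hr : (r : ZMod p) = 0
    · -- `p ∣ r`: a Ramanujan sum, `t = 0`
      have ht0 : t = 0 := by rw [ht, hr, neg_zero]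
      have hterm : ∀ y : ZMod p, ((quadraticChar (ZMod p) (y * (y - t)) : ℤ) : ℂ) *
          (ZMod.stdAddChar (s * y) : ℂ) =
            (ZMod.stdAddChar (y * s) : ℂ) - if y = 0 then 1 else 0 := by
        intro y
        rw [ht0, sub_zero, mul_comm s y]
        by_cases hy : y = 0
        · simp [hy]
        · rw [← sq, quadraticChar_sq_one' hy, if_neg hy]
          push_cast
          ring
      simp_rw [hterm]
      rw [Finset.sum_sub_distrib, Finset.sum_ite_eq' Finset.univ (0 : ZMod p),
        if_pos (mem_univ _), AddChar.sum_mulShift s (ZMod.isPrimitive_stdAddChar p), ZMod.card p]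
      by_cases hb : b = 0
      · have hs0 : s = 0 := by rw [hs, hb, mul_zero, neg_zero]
        rw [if_pos hs0, if_pos hb, if_pos hr]
        have : ((p : ℂ) - 1) = ((p - 1 : ℝ) : ℂ) := by push_cast; ring
        rw [this, Complex.norm_real, Real.norm_eq_abs, abs_of_nonneg (by linarith)]
      · have hs0 : s ≠ 0 := by
          rw [hs]
          exact neg_ne_zero.mpr (mul_ne_zero (inv_ne_zero hk) hb)
        rw [if_neg hs0, if_neg hb, Nat.cast_zero, zero_sub, norm_neg, norm_one]
        linarith
    · -- `p ∤ r`: Jacobsthal (`s = 0`) or Salié–Kloosterman (`s ≠ 0`)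
      have ht0 : t ≠ 0 := by
        rw [ht]
        exact neg_ne_zero.mpr hr
      by_cases hb : b = 0
      · have hs0 : s = 0 := by rw [hs, hb, mul_zero, neg_zero]
        simp only [hs0, zero_mul, AddChar.map_zero_eq_one, mul_one]
        rw [sum_quadraticChar_mul_sub_eq_neg_one hp2 ht0, norm_neg, norm_one, if_pos hb, if_neg hr]
      · rw [sum_quadraticChar_mul_sub_mul_stdAddChar hp2 ht0 s, norm_mul, AddChar.norm_apply,
          one_mul, if_neg hb]
        exact norm_kloostermanSum_one_prime_le _

/-! ### 3. The global bound: induction on the odd square-free part -/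

/-- Trivial bound `|S_q(k, r; b)| ≤ q`. [folklore] -/
private theorem norm_twistedShiftSum_le_card {q : ℕ} [NeZero q] (χ : DirichletCharacter ℂ q) (k r : ℤ)
    (b : ZMod q) : ‖twistedShiftSum χ k r b‖ ≤ q := by
  unfold twistedShiftSum
  refine (norm_sum_le _ _).trans ?_
  have h1 : ∀ a ∈ (Finset.univ : Finset (ZMod q)),
      ‖χ a * χ (a * k + r) * (ZMod.stdAddChar (-(a * b)) : ℂ)‖ ≤ 1 := by
    intro a _
    rw [norm_mul, norm_mul, AddChar.norm_apply, mul_one]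
    calc ‖χ a‖ * ‖χ (a * k + r)‖ ≤ 1 * 1 :=
          mul_le_mul (χ.norm_le_one _) (χ.norm_le_one _) (norm_nonneg _) zero_le_one
      _ = 1 := one_mul 1
  refine (Finset.sum_le_sum h1).trans ?_
  rw [Finset.sum_const, Finset.card_univ, ZMod.card, nsmul_eq_mul, mul_one]

/-- Reduction compatibility: for `d ∣ n ∣ N` and a unit `u` of `ℤ/n`, the reduction mod `d` of
`u⁻¹ · (b mod n)` vanishes iff `b mod d` does. [folklore] -/
private theorem cast_cast_mul_inv_eq_zero_iff {N n d : ℕ} [NeZero n] [NeZero d] (hn : n ∣ N) (hd : d ∣ n)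
    {u : ZMod n} (hu : IsUnit u) (b : ZMod N) :
    (ZMod.cast ((ZMod.cast b : ZMod n) * u⁻¹) : ZMod d) = 0 ↔ (ZMod.cast b : ZMod d) = 0 := by
  have h1 : (ZMod.cast ((ZMod.cast b : ZMod n) * u⁻¹) : ZMod d) =
      (ZMod.cast b : ZMod d) * ZMod.castHom hd (ZMod d) u⁻¹ := by
    rw [← ZMod.castHom_apply (h := hd), map_mul, ZMod.castHom_apply, ZMod.castHom_apply,
      zmod_cast_cast hn hd]
  have hunit : IsUnit (ZMod.castHom hd (ZMod d) u⁻¹) := by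
    refine IsUnit.of_mul_eq_one_right (ZMod.castHom hd (ZMod d) u) ?_
    rw [← map_mul, ZMod.mul_inv_of_unit u hu, map_one]
  rw [h1]
  exact hunit.mul_left_eq_zero

/-- **`|S_q(k, r; b)| ≤ m ∏_{p ∣ Q} β_p`** for `q = mQ` with `Q` odd square-free and `(m, Q) = 1`,
`χ` primitive quadratic modulo `q`, whenever `β_p` bounds `|S_p|` for every primitive quadratic
character modulo `p` and every twist `b'` with `p ∣ b' ⇔ p ∣ b` (induction on `Q`, one prime at a
time by `twistedShiftSum_eq_mul_of_coprime`; the cofactor `m` — in the application the `2`-part —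
is bounded trivially). [cite: BondarenkoHeap2026, §4 proof of Lemma 4 (TeX l.530–545)] -/
theorem norm_twistedShiftSum_le_mul_prod (Q : ℕ) :
    Odd Q → Squarefree Q → ∀ (q m : ℕ) [NeZero q], q = m * Q → m.Coprime Q →
    ∀ (χ : DirichletCharacter ℂ q), χ.IsPrimitive → χ.IsQuadratic →
    ∀ (k r : ℤ) (b : ZMod q) (B : ℕ → ℝ), (∀ p ∈ Q.primeFactors, 0 ≤ B p) →
      (∀ (p : ℕ) [NeZero p], p ∈ Q.primeFactors → ∀ ψ : DirichletCharacter ℂ p,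
        ψ.IsPrimitive → ψ.IsQuadratic → ∀ b' : ZMod p, (b' = 0 ↔ (ZMod.cast b : ZMod p) = 0) →
          ‖twistedShiftSum ψ k r b'‖ ≤ B p) →
      ‖twistedShiftSum χ k r b‖ ≤ m * ∏ p ∈ Q.primeFactors, B p := by
  induction Q using Nat.strong_induction_on with
  | _ Q ih =>
  intro hQodd hQsf q m _ hq hmQ χ hprim hquad k r b B hB0 hB
  have hQ0 : Q ≠ 0 := by
    rintro rfl
    exact (Nat.not_odd_zero hQodd).elim
  by_cases hQ1 : Q = 1
  · subst hQ1
    rw [Nat.primeFactors_one, Finset.prod_empty, mul_one]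
    have hqm : (q : ℝ) = m := by rw [hq, mul_one]
    rw [← hqm]
    exact norm_twistedShiftSum_le_card χ k r b
  · -- peel off the least prime factor `p` of `Q`
    set p := Q.minFac with hp_def
    have hp : p.Prime := Nat.minFac_prime hQ1
    have hpQ : p ∣ Q := Nat.minFac_dvd Q
    set Q' := Q / p with hQ'_def
    have hQeq : Q = p * Q' := (Nat.mul_div_cancel' hpQ).symm
    have hQ'dvd : Q' ∣ Q := Nat.div_dvd_of_dvd hpQ
    have hQ'0 : Q' ≠ 0 := by
      intro h
      rw [h, mul_zero] at hQeq
      exact hQ0 hQeq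
    have hpQ' : p.Coprime Q' := PrimitiveQuadratic.coprime_div_of_squarefree hQsf hp hpQ
    have hQ'lt : Q' < Q := by
      rw [hQ'_def]
      exact Nat.div_lt_self (Nat.pos_of_ne_zero hQ0) hp.one_lt
    have hQ'odd : Odd Q' := hQodd.of_dvd_nat hQ'dvd
    have hQ'sf : Squarefree Q' := hQsf.squarefree_of_dvd hQ'dvd
    have hpm : p.Coprime m := Nat.Coprime.coprime_dvd_left hpQ hmQ.symm
    have hc : p.Coprime (m * Q') := Nat.Coprime.mul_right hpm hpQ'
    have hmQ' : m.Coprime Q' := hmQ.coprime_dvd_right hQ'dvd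
    have hq' : q = p * (m * Q') := by rw [hq, hQeq]; ring
    subst hq'
    haveI : NeZero p := ⟨hp.ne_zero⟩
    have hmQ'0 : m * Q' ≠ 0 := fun h => NeZero.ne (p * (m * Q')) (by rw [h, mul_zero])
    haveI : NeZero (m * Q') := ⟨hmQ'0⟩
    rw [twistedShiftSum_eq_mul_of_coprime hc χ k r b, norm_mul]
    -- the local factor at `p`
    have hpmem : p ∈ Q.primeFactors := Nat.mem_primeFactors.mpr ⟨hp, hpQ, hQ0⟩
    have hu1 : IsUnit (((m * Q' : ℕ) : ZMod p)) := (ZMod.isUnit_iff_coprime _ _).mpr hc.symm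
    have hb₁ : (ZMod.cast b : ZMod p) * ((m * Q' : ℕ) : ZMod p)⁻¹ = 0 ↔
        (ZMod.cast b : ZMod p) = 0 := by
      have hunit : IsUnit (((m * Q' : ℕ) : ZMod p)⁻¹) :=
        IsUnit.of_mul_eq_one_right _ (ZMod.mul_inv_of_unit _ hu1)
      exact hunit.mul_left_eq_zero
    have hloc := hB p hpmem (crtFst hc χ) (isPrimitive_crtFst hc hprim)
      (IsQuadratic.crtFst hc hquad) _ hb₁
    -- the cofactor, by induction
    have hu2 : IsUnit ((p : ZMod (m * Q'))) := (ZMod.isUnit_iff_coprime _ _).mpr hc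
    have hB' : ∀ (p' : ℕ) [NeZero p'], p' ∈ Q'.primeFactors → ∀ ψ : DirichletCharacter ℂ p',
        ψ.IsPrimitive → ψ.IsQuadratic → ∀ b' : ZMod p',
          (b' = 0 ↔ (ZMod.cast ((ZMod.cast b : ZMod (m * Q')) * (p : ZMod (m * Q'))⁻¹) :
            ZMod p') = 0) → ‖twistedShiftSum ψ k r b'‖ ≤ B p' := by
      intro p' _ hp' ψ hψp hψq b' hb'
      refine hB p' (Nat.primeFactors_mono hQ'dvd hQ0 hp') ψ hψp hψq b' ?_
      rw [hb']
      have hd : p' ∣ m * Q' := ((Nat.mem_primeFactors.mp hp').2.1).trans (dvd_mul_left Q' m)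
      exact cast_cast_mul_inv_eq_zero_iff (dvd_mul_left (m * Q') p) hd hu2 b
    have hih := ih Q' hQ'lt hQ'odd hQ'sf (m * Q') m rfl hmQ' (crtSnd hc χ)
      (isPrimitive_crtSnd hc hprim) (IsQuadratic.crtSnd hc hquad) k r _ B
      (fun p' hp' => hB0 p' (Nat.primeFactors_mono hQ'dvd hQ0 hp')) hB'
    -- combine
    have hpnot : p ∉ Q'.primeFactors := fun h =>
      (hp.coprime_iff_not_dvd.mp hpQ') (Nat.mem_primeFactors.mp h).2.1
    have hpf : Q.primeFactors = insert p Q'.primeFactors := by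
      rw [hQeq, Nat.primeFactors_mul hp.ne_zero hQ'0, hp.primeFactors, Finset.insert_eq]
    rw [hpf, Finset.prod_insert hpnot]
    calc ‖twistedShiftSum (crtFst hc χ) k r ((ZMod.cast b : ZMod p) * ((m * Q' : ℕ) : ZMod p)⁻¹)‖ *
          ‖twistedShiftSum (crtSnd hc χ) k r
            ((ZMod.cast b : ZMod (m * Q')) * (p : ZMod (m * Q'))⁻¹)‖
        ≤ B p * (m * ∏ p' ∈ Q'.primeFactors, B p') :=
          mul_le_mul hloc hih (norm_nonneg _) (hB0 p hpmem)
      _ = m * (B p * ∏ p' ∈ Q'.primeFactors, B p') := by ring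

/-! ### 4. The two products of local bounds -/

/-- A product of distinct primes of the square-free `Q`, each dividing `n`, is at most `(n, Q)`.
[folklore] -/
private theorem prod_filter_primeFactors_le_gcd {Q : ℕ} (hQsf : Squarefree Q) (hQ0 : Q ≠ 0) (n : ℕ)
    (P : ℕ → Prop) [DecidablePred P] (hP : ∀ p ∈ Q.primeFactors, P p → p ∣ n) :
    (∏ p ∈ Q.primeFactors.filter P, p) ≤ Nat.gcd n Q := by
  have h1 : (∏ p ∈ Q.primeFactors.filter P, p) ∣ Q := by
    calc (∏ p ∈ Q.primeFactors.filter P, p) ∣ ∏ p ∈ Q.primeFactors, p :=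
          Finset.prod_dvd_prod_of_subset _ _ _ (Finset.filter_subset _ _)
      _ = Q := Nat.prod_primeFactors_of_squarefree hQsf
  have h2 : (∏ p ∈ Q.primeFactors.filter P, p) ∣ n :=
    Finset.prod_primes_dvd n
      (fun p hp => (Nat.prime_of_mem_primeFactors (Finset.mem_filter.1 hp).1).prime)
      (fun p hp => hP p (Finset.mem_filter.1 hp).1 (Finset.mem_filter.1 hp).2)
  exact Nat.le_of_dvd (Nat.gcd_pos_of_pos_right _ (Nat.pos_of_ne_zero hQ0)) (Nat.dvd_gcd h2 h1)

/-- The `b = 0` product: `∏_{p ∣ Q} ([p ∣ r](p − 1) + [p ∤ r]) ≤ (r, Q)`.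
[cite: BondarenkoHeap2026, §4 (14), first bound] -/
theorem prod_localBound_zero_le {Q : ℕ} (hQsf : Squarefree Q) (hQ0 : Q ≠ 0) (r : ℤ) :
    ∏ p ∈ Q.primeFactors, (if (r : ZMod p) = 0 then (p : ℝ) - 1 else 1) ≤ Int.gcd r Q := by
  have hle : ∏ p ∈ Q.primeFactors, (if (r : ZMod p) = 0 then (p : ℝ) - 1 else 1) ≤
      ∏ p ∈ Q.primeFactors, (if p ∣ r.natAbs then (p : ℝ) else 1) := by
    refine Finset.prod_le_prod (fun p hp => ?_) fun p hp => ?_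
    · have : (2 : ℝ) ≤ p := by exact_mod_cast (Nat.prime_of_mem_primeFactors hp).two_le
      split_ifs <;> linarith
    · haveI : NeZero p := ⟨(Nat.prime_of_mem_primeFactors hp).ne_zero⟩
      have hiff : (r : ZMod p) = 0 ↔ p ∣ r.natAbs := by
        rw [ZMod.intCast_zmod_eq_zero_iff_dvd, Int.natCast_dvd]
      by_cases h : p ∣ r.natAbs
      · rw [if_pos (hiff.mpr h), if_pos h]
        linarith
      · rw [if_neg (fun h' => h (hiff.mp h')), if_neg h]
  refine hle.trans ?_
  rw [← Finset.prod_filter]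
  have h := prod_filter_primeFactors_le_gcd hQsf hQ0 r.natAbs (fun p => p ∣ r.natAbs)
    (fun p _ h => h)
  have hgcd : Nat.gcd r.natAbs Q = Int.gcd r Q := by
    simp [Int.gcd]
  rw [hgcd] at h
  have h' : ((∏ p ∈ Q.primeFactors.filter (fun p => p ∣ r.natAbs), p : ℕ) : ℝ) ≤
      (Int.gcd r Q : ℝ) := by exact_mod_cast h
  rw [Nat.cast_prod] at h'
  exact h'

/-- The `b ≠ 0` product: `∏_{p ∣ Q} β_p ≤ d(Q) √Q (r, n, Q)^{1/2}` (`n` the twist).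
[cite: BondarenkoHeap2026, §4 (14), second bound] -/
theorem prod_localBound_le {Q : ℕ} (hQsf : Squarefree Q) (hQ0 : Q ≠ 0) (r : ℤ) (n : ℕ) :
    ∏ p ∈ Q.primeFactors,
        (if (n : ZMod p) = 0 then (if (r : ZMod p) = 0 then (p : ℝ) - 1 else 1)
          else 2 * Real.sqrt p) ≤
      Q.divisors.card * Real.sqrt Q * Real.sqrt (Nat.gcd (Nat.gcd r.natAbs n) Q) := by
  set ι : ℕ → ℝ := fun p => if p ∣ r.natAbs ∧ p ∣ n then Real.sqrt p else 1 with hι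
  -- termwise comparison with `2 √p ι_p`
  have hle : ∏ p ∈ Q.primeFactors,
      (if (n : ZMod p) = 0 then (if (r : ZMod p) = 0 then (p : ℝ) - 1 else 1)
        else 2 * Real.sqrt p) ≤ ∏ p ∈ Q.primeFactors, 2 * (Real.sqrt p * ι p) := by
    refine Finset.prod_le_prod (fun p hp => ?_) fun p hp => ?_
    · have : (2 : ℝ) ≤ p := by exact_mod_cast (Nat.prime_of_mem_primeFactors hp).two_le
      split_ifs <;> first | linarith | positivity
    have hpP := Nat.prime_of_mem_primeFactors hp
    haveI : NeZero p := ⟨hpP.ne_zero⟩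
    have hp1 : (1 : ℝ) ≤ Real.sqrt p := by
      rw [show (1 : ℝ) = Real.sqrt 1 by simp]
      exact Real.sqrt_le_sqrt (by exact_mod_cast hpP.one_lt.le)
    have hpp : Real.sqrt p * Real.sqrt p = p := Real.mul_self_sqrt (Nat.cast_nonneg p)
    have hι1 : 1 ≤ ι p := by
      simp only [hι]
      split_ifs <;> linarith
    have hiffn := ZMod.natCast_eq_zero_iff n p
    have hiffr : (r : ZMod p) = 0 ↔ p ∣ r.natAbs := by
      rw [ZMod.intCast_zmod_eq_zero_iff_dvd, Int.natCast_dvd]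
    by_cases hn : p ∣ n
    · by_cases hr : p ∣ r.natAbs
      · rw [if_pos (hiffn.mpr hn), if_pos (hiffr.mpr hr)]
        have : ι p = Real.sqrt p := by simp only [hι, if_pos (And.intro hr hn)]
        rw [this, hpp]
        linarith
      · rw [if_pos (hiffn.mpr hn), if_neg (fun h' => hr (hiffr.mp h'))]
        nlinarith
    · rw [if_neg (fun h' => hn (hiffn.mp h'))]
      nlinarith
  refine hle.trans ?_
  rw [Finset.prod_mul_distrib, Finset.prod_const, Finset.prod_mul_distrib]
  -- `∏ √p = √Q`
  have hsq : ∏ p ∈ Q.primeFactors, Real.sqrt p = Real.sqrt Q := by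
    rw [← Real.sqrt_prod _ (fun p _ => Nat.cast_nonneg p), ← Nat.cast_prod,
      Nat.prod_primeFactors_of_squarefree hQsf]
  -- `∏ ι_p = √(∏_{p ∣ r, p ∣ n} p) ≤ √ gcd`
  have hιeq : ∏ p ∈ Q.primeFactors, ι p =
      Real.sqrt ((∏ p ∈ Q.primeFactors.filter (fun p => p ∣ r.natAbs ∧ p ∣ n), p : ℕ) : ℝ) := by
    rw [Nat.cast_prod, Real.sqrt_prod _ (fun p _ => Nat.cast_nonneg p), Finset.prod_filter]
  have hιle : ∏ p ∈ Q.primeFactors, ι p ≤ Real.sqrt (Nat.gcd (Nat.gcd r.natAbs n) Q) := by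
    rw [hιeq]
    refine Real.sqrt_le_sqrt ?_
    have h := prod_filter_primeFactors_le_gcd hQsf hQ0 (Nat.gcd r.natAbs n)
      (fun p => p ∣ r.natAbs ∧ p ∣ n) (fun p _ h => Nat.dvd_gcd h.1 h.2)
    exact_mod_cast h
  -- `2^{ω(Q)} ≤ d(Q)` (the tree has this in several places, e.g.
  -- `SquarefulSumsCountingTools.two_pow_card_primeFactors_le_card_divisors`; four lines inline)
  have h2nat : 2 ^ Q.primeFactors.card ≤ Q.divisors.card := by
    rw [Nat.card_divisors hQ0]
    refine Finset.pow_card_le_prod _ _ _ fun p hp => ?_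
    have := (Nat.prime_of_mem_primeFactors hp).factorization_pos_of_dvd hQ0
      (Nat.dvd_of_mem_primeFactors hp)
    omega
  have h2 : (2 : ℝ) ^ Q.primeFactors.card ≤ Q.divisors.card := by exact_mod_cast h2nat
  rw [hsq]
  have h0 : 0 ≤ Real.sqrt Q := Real.sqrt_nonneg _
  have h0' : 0 ≤ ∏ p ∈ Q.primeFactors, ι p :=
    Finset.prod_nonneg fun p _ => by simp only [hι]; split_ifs <;> positivity
  calc (2 : ℝ) ^ Q.primeFactors.card * (Real.sqrt Q * ∏ p ∈ Q.primeFactors, ι p)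
      ≤ Q.divisors.card * (Real.sqrt Q * Real.sqrt (Nat.gcd (Nat.gcd r.natAbs n) Q)) := by
        gcongr
    _ = Q.divisors.card * Real.sqrt Q * Real.sqrt (Nat.gcd (Nat.gcd r.natAbs n) Q) := by ring

end CompleteSums

/-! ### 5. Assembly: (14) -/

open CompleteSums in
/-- **(14), proved**: for the primitive quadratic character `χ` modulo `q = 2^ν Q` (`Q` odd) and
nonzero `k, r`, `|S_q(k, r; 0)| ≤ C q^ε (r, Q)` and `|S_q(k, r; b)| ≤ C q^{1/2+ε} (r, b, Q)^{1/2}`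
(`b ≠ 0`), with `C = 8 C_ε`, `C_ε` the divisor-bound constant. Discharges the named fact `eq14`.
[cite: BondarenkoHeap2026, §4 (14) p. 11 (TeX l.546–550)] -/
theorem eq14_holds : eq14 := by
  intro ε hε
  obtain ⟨Cd, hCd1, hCd⟩ := Literature.NumberTheory.Sieve.exists_card_divisors_le_mul_rpow hε
  refine ⟨8 * Cd, by positivity, ?_⟩
  intro q _ χ hprim hquad ν Q hq hQodd k r _ _
  subst hq
  -- the structure of the modulus: `Q` square-free, `2^ν ≤ 8`
  have hQ0 : Q ≠ 0 := by
    rintro rfl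
    exact (Nat.not_odd_zero hQodd).elim
  haveI : NeZero Q := ⟨hQ0⟩
  haveI : NeZero (2 ^ ν) := ⟨pow_ne_zero _ two_ne_zero⟩
  have hcop : (2 ^ ν).Coprime Q := (Nat.coprime_two_left.mpr hQodd).pow_left ν
  have hQsf : Squarefree Q :=
    PrimitiveQuadratic.squarefree_of_isPrimitive_of_isQuadratic hQodd
      (isPrimitive_crtSnd hcop hprim) (IsQuadratic.crtSnd hcop hquad)
  have h8 : ((2 ^ ν : ℕ) : ℝ) ≤ 8 := by
    rcases Nat.eq_zero_or_pos ν with hν | hν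
    · rw [hν]; norm_num
    · rcases eq_two_or_three_of_isPrimitive_two_pow hν (crtFst hcop χ)
          (isPrimitive_crtFst hcop hprim) (IsQuadratic.crtFst hcop hquad) with h | h <;>
        rw [h] <;> norm_num
  set qR : ℝ := ((2 ^ ν * Q : ℕ) : ℝ) with hqR
  have hq1 : 1 ≤ qR := by
    rw [hqR]
    exact_mod_cast Nat.one_le_iff_ne_zero.mpr (NeZero.ne (2 ^ ν * Q))
  have hqε : 1 ≤ qR ^ ε := Real.one_le_rpow hq1 hε.le
  have hQq : (Q : ℝ) ≤ qR := by
    rw [hqR]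
    exact_mod_cast Nat.le_mul_of_pos_left Q (Nat.pos_of_ne_zero (NeZero.ne (2 ^ ν)))
  have hqR0 : 0 < qR := lt_of_lt_of_le one_pos hq1
  -- the local bounds at the odd primes of `Q`
  have hlocal : ∀ (b : ZMod (2 ^ ν * Q)) (p : ℕ) [NeZero p], p ∈ Q.primeFactors →
      ∀ ψ : DirichletCharacter ℂ p, ψ.IsPrimitive → ψ.IsQuadratic → ∀ b' : ZMod p,
        (b' = 0 ↔ (ZMod.cast b : ZMod p) = 0) →
        ‖twistedShiftSum ψ k r b'‖ ≤
          (if (ZMod.cast b : ZMod p) = 0 then (if (r : ZMod p) = 0 then (p : ℝ) - 1 else 1)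
            else 2 * Real.sqrt p) := by
    intro b p _ hp ψ hψp hψq b' hb'
    have hpP := Nat.prime_of_mem_primeFactors hp
    haveI : Fact p.Prime := ⟨hpP⟩
    have hp2 : p ≠ 2 := by
      rintro rfl
      exact hQodd.not_two_dvd_nat (Nat.dvd_of_mem_primeFactors hp)
    have hψ1 : ψ ≠ 1 := by
      intro h1
      have h2 := hψp
      rw [DirichletCharacter.isPrimitive_def, h1, DirichletCharacter.conductor_one] at h2
      exact hpP.one_lt.ne h2
    have h := norm_twistedShiftSum_prime_le hp2 ψ hψ1 hψq k r b'
    by_cases hb0 : b' = 0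
    · rw [if_pos hb0] at h
      rwa [if_pos (hb'.mp hb0)]
    · rw [if_neg hb0] at h
      rwa [if_neg (fun h0 => hb0 (hb'.mpr h0))]
  have hBnn : ∀ (b : ZMod (2 ^ ν * Q)), ∀ p ∈ Q.primeFactors,
      (0 : ℝ) ≤ (if (ZMod.cast b : ZMod p) = 0 then (if (r : ZMod p) = 0 then (p : ℝ) - 1 else 1)
        else 2 * Real.sqrt p) := by
    intro b p hp
    have : (2 : ℝ) ≤ p := by exact_mod_cast (Nat.prime_of_mem_primeFactors hp).two_le
    split_ifs <;> first | linarith | positivity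
  refine ⟨?_, fun b hb => ?_⟩
  · -- `b = 0`: `|S| ≤ 2^ν ∏ β_p ≤ 8 (r, Q)`
    have hmain := norm_twistedShiftSum_le_mul_prod Q hQodd hQsf (2 ^ ν * Q) (2 ^ ν) rfl hcop χ
      hprim hquad k r 0 _ (hBnn 0) (hlocal 0)
    have hprod0 : ∏ p ∈ Q.primeFactors,
        (if (ZMod.cast (0 : ZMod (2 ^ ν * Q)) : ZMod p) = 0 then
          (if (r : ZMod p) = 0 then (p : ℝ) - 1 else 1) else 2 * Real.sqrt p) =
        ∏ p ∈ Q.primeFactors, (if (r : ZMod p) = 0 then (p : ℝ) - 1 else 1) := by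
      refine Finset.prod_congr rfl fun p _ => ?_
      rw [ZMod.cast_zero, if_pos rfl]
    rw [hprod0] at hmain
    have hprod := prod_localBound_zero_le hQsf hQ0 r
    have hnn : 0 ≤ ∏ p ∈ Q.primeFactors, (if (r : ZMod p) = 0 then (p : ℝ) - 1 else 1) :=
      Finset.prod_nonneg fun p hp => by
        have : (2 : ℝ) ≤ p := by exact_mod_cast (Nat.prime_of_mem_primeFactors hp).two_le
        split_ifs <;> linarith
    calc ‖twistedShiftSum χ k r 0‖
        ≤ ((2 ^ ν : ℕ) : ℝ) * ∏ p ∈ Q.primeFactors, (if (r : ZMod p) = 0 then (p : ℝ) - 1 else 1) :=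
          hmain
      _ ≤ 8 * (Int.gcd r Q : ℝ) := mul_le_mul h8 hprod hnn (by norm_num)
      _ = 8 * 1 * 1 * (Int.gcd r Q : ℝ) := by ring
      _ ≤ 8 * Cd * qR ^ ε * (Int.gcd r Q : ℝ) := by gcongr
  · -- `b ≠ 0`: `|S| ≤ 2^ν ∏ β_p ≤ 8 d(Q) √Q (r, b, Q)^{1/2}`
    have hmain := norm_twistedShiftSum_le_mul_prod Q hQodd hQsf (2 ^ ν * Q) (2 ^ ν) rfl hcop χ
      hprim hquad k r b _ (hBnn b) (hlocal b)
    have hprod0 : ∏ p ∈ Q.primeFactors,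
        (if (ZMod.cast b : ZMod p) = 0 then
          (if (r : ZMod p) = 0 then (p : ℝ) - 1 else 1) else 2 * Real.sqrt p) =
        ∏ p ∈ Q.primeFactors, (if (b.val : ZMod p) = 0 then
          (if (r : ZMod p) = 0 then (p : ℝ) - 1 else 1) else 2 * Real.sqrt p) := by
      refine Finset.prod_congr rfl fun p _ => ?_
      rw [ZMod.cast_eq_val]
    rw [hprod0] at hmain
    have hprod := prod_localBound_le hQsf hQ0 r b.val
    set g : ℕ := Nat.gcd (Nat.gcd r.natAbs b.val) Q with hg
    have hgeq : (Int.gcd (Int.gcd r b.val) Q : ℕ) = g := by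
      rw [hg, Int.gcd_natCast_natCast]
      rfl
    have hnn : 0 ≤ ∏ p ∈ Q.primeFactors, (if (b.val : ZMod p) = 0 then
        (if (r : ZMod p) = 0 then (p : ℝ) - 1 else 1) else 2 * Real.sqrt p) :=
      Finset.prod_nonneg fun p hp => by
        have : (2 : ℝ) ≤ p := by exact_mod_cast (Nat.prime_of_mem_primeFactors hp).two_le
        split_ifs <;> first | linarith | positivity
    have hdQ : (Q.divisors.card : ℝ) ≤ Cd * (Q : ℝ) ^ ε := hCd Q hQ0
    have hQε : (Q : ℝ) ^ ε ≤ qR ^ ε := Real.rpow_le_rpow (Nat.cast_nonneg Q) hQq hε.le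
    have hsqrt : Real.sqrt Q ≤ Real.sqrt qR := Real.sqrt_le_sqrt hQq
    have hg0 : 0 ≤ Real.sqrt g := Real.sqrt_nonneg _
    have hpow : qR ^ (1 / 2 + ε) = Real.sqrt qR * qR ^ ε := by
      rw [Real.rpow_add hqR0, Real.sqrt_eq_rpow]
    rw [hgeq, hpow]
    calc ‖twistedShiftSum χ k r b‖
        ≤ ((2 ^ ν : ℕ) : ℝ) * ∏ p ∈ Q.primeFactors, (if (b.val : ZMod p) = 0 then
            (if (r : ZMod p) = 0 then (p : ℝ) - 1 else 1) else 2 * Real.sqrt p) := hmain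
      _ ≤ 8 * (Q.divisors.card * Real.sqrt Q * Real.sqrt g) := mul_le_mul h8 hprod hnn (by norm_num)
      _ ≤ 8 * (Cd * (Q : ℝ) ^ ε * Real.sqrt qR * Real.sqrt g) := by gcongr
      _ ≤ 8 * (Cd * qR ^ ε * Real.sqrt qR * Real.sqrt g) := by gcongr
      _ = 8 * Cd * (Real.sqrt qR * qR ^ ε) * Real.sqrt g := by ring

/-- **Lemma 4, proved** (completion lemma for `∑ χ(m)χ(km + r)` against a smooth dyadic weight):
the named fact `lemma4` holds outright, by `lemma4_of_eq14` and `eq14_holds`.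
[cite: BondarenkoHeap2026, Lemma 4, eq. (12) p. 10 (TeX l.495–505)] -/
theorem lemma4_holds : lemma4 :=
  lemma4_of_eq14 eq14_holds

/-- **Range I, (23), proved**: the named fact `rangeI_bound` of §6.3 holds outright, by
`rangeI_bound_of_lemma4` and `lemma4_holds`. [cite: BondarenkoHeap2026, §6.3 (23) (TeX l.864–878)] -/
theorem rangeI_bound_holds : rangeI_bound :=
  rangeI_bound_of_lemma4 lemma4_holds

end BondarenkoHeap2026

end Literature.NumberTheory.LFunctions
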